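import Summits.Ventures.DiscreteObjects.Hadamard.AffineSymmetryQuaternary668

/-!
# Hadamard 668 census — row F7, addendum: conjugation-twisted affine symmetries of a quaternary complementary pair over
# `ZMod 167` also have multiplier `±1` (kernel)

Framing: lottery ticket; floor = certified bounds/negative ranges.

Cell pub-namedobj (venture DiscreteObjects), target (H), hadamard gen 26.  `AffineSymmetryQuaternary668` treats the symmetries
`x_{π k}(h t + c_k) = ε_k x_k(t)` (swap, phases, shifts, multiplier) of a quaternary pair `(x_0, x_1)` on `ZMod 167` with
`CPAF_{x_0} + CPAF_{x_1} = 0` off `0` (two-circulant `CH(334)` ⇒ `H(668)`).  The full symmetry group of the system also contains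
complex CONJUGATION of a row (it conjugates `CPAF`, and the pair condition is conjugation-invariant).  Here the twist may include it:
`x_{π k}(h t + c_k) = ε_k · σ_k(x_k(t))` with `σ_k ∈ {id, conj}` chosen per row.
* `twistQ_mul`, `twistQ_twistQ`, `twistQ_self`, `twistQ_mem` — bookkeeping for the optional conjugation `if b then star z else z`;
* `conjPhaseSymmetry_iterate2`, `conjPhaseRow_iterate2`, `rowAffineInvariant_of_conjPhaseSymmetry` — `π² = 1`, `σ² = id` and `ε⁴ = 1`
  make each row invariant under its own affine map `t ↦ h¹⁶ t + D_k`;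
* **`quatPair167_conjAffineSymmetry_sq_eq_one`** — hence again **`h² = 1`** (`gcd(32,166) = 2`; recentre; `inv4_of_hInvariant`;
  `no_quaternary_pair_qr167`); `quatPair167_no_conjTwistedMultiplier`.
So no multiplier assumption of order `> 2`, twisted by any combination of swap, phases `{±1, ±i}`, conjugation and row-wise shifts, is
available to a `CH(334)` search over `ZMod 167`.  EXCLUSION of symmetry types of a hypothetical object; no Hadamard order excluded;
H(668) untouched; HITS 0/4.  Ours, elementary; no `sorry`; `decide` only on the quaternary units.
-/

open Finset BigOperators

namespace Summit.Ventures.DiscreteObjects.Hadamard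

/-! ## §1 The optional conjugation twist -/

/-! The optional conjugation is written `if b then star z else z` (`b : Bool`, one flag per row); no definition is introduced. -/

/-- the optional conjugation of a product. -/
lemma twistQ_mul (b : Bool) (z w : GaussianInt) :
    (if b then star (z * w) else z * w) = (if b then star z else z) * (if b then star w else w) := by
  cases b
  · rfl
  · exact star_mul' z w

/-- two optional conjugations compose to one (flag `xor`). -/
lemma twistQ_twistQ (b b' : Bool) (z : GaussianInt) :
    (if b then star (if b' then star z else z) else (if b' then star z else z)) = (if xor b b' then star z else z) := by
  cases b <;> cases b' <;> simp

/-- an optional conjugation is an involution. -/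
lemma twistQ_self (b : Bool) (z : GaussianInt) : (if b then star (if b then star z else z) else (if b then star z else z)) = z := by
  cases b <;> simp

/-- the quaternary units are closed under conjugation. -/
lemma quatUnits_star_mem : ∀ u ∈ quatUnits, star u ∈ quatUnits := by decide

/-- hence under optional conjugation. -/
lemma twistQ_mem (b : Bool) {u : GaussianInt} (hu : u ∈ quatUnits) : (if b then star u else u) ∈ quatUnits := by
  cases b
  · exact hu
  · exact quatUnits_star_mem u hu

/-! ## §2 Iterating a conjugation/phase/swap-twisted affine symmetry -/

section Iterate

variable {n : ℕ} {x : Fin 2 → ZMod n → GaussianInt} {h : ZMod n} {c : Fin 2 → ZMod n} {π : Equiv.Perm (Fin 2)}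
  {ε : Fin 2 → GaussianInt} {σ : Fin 2 → Bool}

/-- two steps: since `π² = 1`, each row satisfies `x_k(h² t + C_k) = η_k · τ_k(x_k(t))` with a unit `η_k` and `τ_k ∈ {id, conj}`. -/
lemma conjPhaseSymmetry_iterate2 (hε : ∀ k, ε k ∈ quatUnits)
    (hrel : ∀ k t, x (π k) (h * t + c k) = ε k * (if σ k then star (x k t) else x k t)) :
    ∃ (η : Fin 2 → GaussianInt) (τ : Fin 2 → Bool) (C : Fin 2 → ZMod n), (∀ k, η k ∈ quatUnits) ∧
      ∀ k t, x k (h ^ 2 * t + C k) = η k * (if τ k then star (x k t) else x k t) := by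
  refine ⟨fun k => ε (π k) * (if σ (π k) then star (ε k) else ε k), fun k => xor (σ (π k)) (σ k), fun k => h * c k + c (π k),
    fun k => quatUnits_mul_mem _ (hε _) _ (twistQ_mem _ (hε _)), fun k t => ?_⟩
  have hππ : π (π k) = k := by
    have e := perm_fin2_sq π
    rw [sq, Equiv.ext_iff] at e
    exact e k
  have e1 := hrel (π k) (h * t + c k)
  rw [hππ, hrel k t, twistQ_mul, twistQ_twistQ] at e1
  rw [show h ^ 2 * t + (h * c k + c (π k)) = h * (h * t + c k) + c (π k) by ring, e1, mul_assoc]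

/-- two steps of a single-row twisted relation remove the conjugation: `f (g² t + d') = (η · σ(η)) f(t)`. -/
lemma conjPhaseRow_iterate2 {f : ZMod n → GaussianInt} {g d : ZMod n} {η : GaussianInt} {τ : Bool}
    (hrel : ∀ t, f (g * t + d) = η * (if τ then star (f t) else f t)) :
    ∀ t, f (g ^ 2 * t + (g + 1) * d) = (η * (if τ then star η else η)) * f t := by
  intro t
  have e1 := hrel t
  have e2 := hrel (g * t + d)
  rw [show g ^ 2 * t + (g + 1) * d = g * (g * t + d) + d by ring, e2, e1, twistQ_mul, twistQ_self, mul_assoc]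

/-- **each row is invariant under its own affine map `t ↦ h¹⁶ t + D_k`.** -/
theorem rowAffineInvariant_of_conjPhaseSymmetry (hε : ∀ k, ε k ∈ quatUnits)
    (hrel : ∀ k t, x (π k) (h * t + c k) = ε k * (if σ k then star (x k t) else x k t)) :
    ∃ D : Fin 2 → ZMod n, ∀ k t, x k (h ^ 16 * t + D k) = x k t := by
  obtain ⟨η, τ, C, hη, h2⟩ := conjPhaseSymmetry_iterate2 hε hrel
  -- two more steps remove the conjugation: multiplier `h⁴`, unit phase `θ_k = η_k · τ_k(η_k)`
  have h4 : ∀ k t, x k ((h ^ 2) ^ 2 * t + (h ^ 2 + 1) * C k) = (η k * (if τ k then star (η k) else η k)) * x k t :=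
    fun k => conjPhaseRow_iterate2 (h2 k)
  -- four more steps kill the phase
  refine ⟨fun k => (((h ^ 2) ^ 2) ^ 3 + ((h ^ 2) ^ 2) ^ 2 + (h ^ 2) ^ 2 + 1) * ((h ^ 2 + 1) * C k), fun k t => ?_⟩
  have e := phaseRow_iterate4 (f := x k) (g := (h ^ 2) ^ 2) (d := (h ^ 2 + 1) * C k) (η := η k * (if τ k then star (η k) else η k)) (h4 k) t
  rw [quatUnits_pow_four _ (quatUnits_mul_mem _ (hη k) _ (twistQ_mem _ (hη k))), one_mul,
    show ((h ^ 2) ^ 2) ^ 4 = h ^ 16 by ring] at e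
  exact e

end Iterate

/-! ## §3 The exclusion with conjugation twists -/

/-- **EXCLUSION (row F7, conjugation allowed).**  Let `x_0, x_1` be quaternary sequences on `ZMod 167` with
`CPAF_{x_0}(s) + CPAF_{x_1}(s) = 0` for `s ≠ 0`, and suppose `x_{π k}(h t + c_k) = ε_k · σ_k(x_k(t))` for all `k, t` with `π ∈ S₂`, phases
`ε_k ∈ {±1, ±i}`, `σ_k ∈ {id, conj}`, row-wise shifts `c_k` and any `h ∈ ZMod 167`.  Then `h² = 1`. -/
theorem quatPair167_conjAffineSymmetry_sq_eq_one (x : Fin 2 → ZMod 167 → GaussianInt) (hq : ∀ k, IsQuat (x k))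
    (hC : ∀ s : ZMod 167, s ≠ 0 → CPAF (x 0) s + CPAF (x 1) s = 0) {h : ZMod 167} {c : Fin 2 → ZMod 167}
    {π : Equiv.Perm (Fin 2)} {ε : Fin 2 → GaussianInt} {σ : Fin 2 → Bool} (hε : ∀ k, ε k ∈ quatUnits)
    (hrel : ∀ k t, x (π k) (h * t + c k) = ε k * (if σ k then star (x k t) else x k t)) : h ^ 2 = 1 := by
  haveI : Fact (Nat.Prime 167) := ⟨by norm_num⟩
  by_contra hsq
  obtain ⟨D, hD⟩ := rowAffineInvariant_of_conjPhaseSymmetry hε hrel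
  by_cases h0 : h = 0
  · subst h0
    have hconst : ∀ k t, x k t = x k 0 := fun k t => by
      have e1 := hD k t
      have e2 := hD k 0
      rw [zero_pow (by norm_num), zero_mul, zero_add] at e1 e2
      rw [← e1, e2]
    have e := hC 1 one_ne_zero
    rw [cpaf_one_of_constant (hq 0) (hconst 0), cpaf_one_of_constant (hq 1) (hconst 1)] at e
    norm_num at e
  · set g : ZMod 167 := h ^ 16 with hg
    have hF : h ^ 166 = 1 := by simpa using ZMod.pow_card_sub_one_eq_one h0
    have hg2 : g ^ 2 ≠ 1 := by
      intro h32
      rw [hg, ← pow_mul, show 16 * 2 = 32 by norm_num] at h32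
      have h2 : h ^ Nat.gcd 32 166 = 1 := pow_gcd_eq_one.2 ⟨h32, hF⟩
      rw [show Nat.gcd 32 166 = 2 by decide] at h2
      exact hsq h2
    have hg1 : g ≠ 1 := fun h1 => hg2 (by rw [h1, one_pow])
    have hg0 : g ≠ 0 := by rw [hg]; exact pow_ne_zero _ h0
    set u : (ZMod 167)ˣ := Units.mk0 g hg0 with hu
    have hug : (u : ZMod 167) = g := rfl
    have husq : (u : ZMod 167) ^ 2 ≠ 1 := by rwa [hug]
    have hrow : ∀ k, ∃ μ : ZMod 167, ∀ i, (fun j => x k (j + μ)) (4 * i) = (fun j => x k (j + μ)) i := by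
      intro k
      obtain ⟨μ, hμ⟩ := recentre_of_affineInvariant (f := x k) hg1 (hD k)
      refine ⟨μ, inv4_of_hInvariant (fun j => x k (j + μ)) u husq fun i => ?_⟩
      show x k ((u : ZMod 167) * i + μ) = x k (i + μ)
      rw [hug]
      exact hμ i
    choose μ hμ using hrow
    refine no_quaternary_pair_qr167 (fun j => x 0 (j + μ 0)) (fun j => x 1 (j + μ 1)) (isQuat_translate (hq 0) _)
      (isQuat_translate (hq 1) _) (hμ 0) (hμ 1) fun s hs => ?_
    rw [cpaf_translate, cpaf_translate]
    exact hC s hs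

/-- **negative line: no conjugation/phase/swap/shift-twisted multiplier with `h ∉ {1, -1}`** for a quaternary two-circulant `CH(334)`
over `ZMod 167`.  lottery ticket; floor = certified bounds/negative ranges. -/
theorem quatPair167_no_conjTwistedMultiplier {h : ZMod 167} (h1 : h ≠ 1) (hm1 : h ≠ -1) (c : Fin 2 → ZMod 167)
    (π : Equiv.Perm (Fin 2)) (ε : Fin 2 → GaussianInt) (σ : Fin 2 → Bool) (hε : ∀ k, ε k ∈ quatUnits) :
    ¬ ∃ x : Fin 2 → ZMod 167 → GaussianInt, (∀ k, IsQuat (x k)) ∧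
      (∀ s : ZMod 167, s ≠ 0 → CPAF (x 0) s + CPAF (x 1) s = 0) ∧ ∀ k t, x (π k) (h * t + c k) = ε k * (if σ k then star (x k t) else x k t) :=
  fun ⟨x, hq, hC, hrel⟩ => by
    haveI : Fact (Nat.Prime 167) := ⟨by norm_num⟩
    have hsq := quatPair167_conjAffineSymmetry_sq_eq_one x hq hC hε hrel
    rcases mul_self_eq_one_iff.mp (show h * h = 1 by rw [← sq]; exact hsq) with e | e
    · exact h1 e
    · exact hm1 e

end Summit.Ventures.DiscreteObjects.Hadamard
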